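import Literature.MathematicalPhysics.QuantumFieldTheory.Balaban1983to89.Node00.N24NodesStage13PinX3HSSepCoPH
import Literature.MathematicalPhysics.QuantumFieldTheory.Balaban1983to89.Node00.Record13CarriersXPinnedPSViewCoPH

/-!
# NODE 00 (YM-PLAN Track A) — dag-n24-c's FOUR-PIN ENGINE READ AT THE P-PINNED PARAMETER `X' := XPinned₁₃P θ λ₈ λ₁₂ λ₁₃`: the thirteen nodes, (B) at the datum, the θ-keyed K1⁷
# consequent, the live re-pin witness and the REGISTERED RUNG BODIES (`NodesAtSomeRecordS` ∕ `BetaWindowAtSomeRecordS` shapes), with **N05 ← the NON-EMPTY P-slot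
# `B8LeafOfRecordSubBP θ₃ λ₈`** — P-instances of the X′-GENERIC §1 ∕ §2 ∕ §4 lemmas of `Node00/N24NodesStage13PinX3HSSepCoPH` (dag-n24-c), exactly as its §3 ∕ §4 H-instances
# instantiate them at `XPinned₁₃H`

P-CARRIER IMAGE (width seat `pub-ymgap-dag-n05-w4` g2, 2026-08-28; token map T_P «`pinX3H ↦ pinX3P`, `XPinned₁₃H ↦ XPinned₁₃P`, `SubBH ↦ SubBP`,
`N24_upS_pinX3H_view_b8_iff_H ↦ Record13CarriersXPinnedPSViewCoPH.socket05S_view₁₃CoPHB10YZW_pinX3P_iff`, `socket09∕10_pinX3H_iff ↦ Record13CarriersXPinnedP.socket09∕10_pinX3P_iff`»)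
of the SIX H-instance theorems of dag-n24-c's `N24NodesStage13PinX3HSSepCoPH` §3–§4 (p-era 2026-08-27); the X′-generic engine (`N24_nodes₁₃CoPH_rebindXS_fourPin_pointed`,
`N24_endStatementBPrinted₁₃CoPH_rebindXS_fourPin_pointed`, `N24_stabilityBR13SepCoPH_thetaShape20_rebindXS_fourPin_pointed`, `N24_nodesAtSomeRecordS₁₃SepCoPH_of_rebindXS_fourPin_pointed`,
`N24_betaWindowAtSomeRecordS₁₃SepCoPH_of_rebindXS_fourPin_pointed_of_boxH`) is CITED BY NAME, nothing of it restated.  APPEND-ONLY: a NEW importing module; dag-n24-c keeps the engine and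
its H-instances; plan g82 START-LIST v9 §n05 WORD «YES, key N05 on X3P» (2026-08-28T03:18Z) is the licence for the P key.

WHY.  The H-instances read N05 at `B8LeafOfRecordSubBH θ₃ λ₈` — the [B8″H] slot certified EMPTY for every admissible `θ` and every layer (`B8Prop3ShellModeVacuity.not_b8LeafOfRecordSubBH`,
dag-n05-d p585094), so every H-keyed closer is vacuous in its `h05` antecedent (A6).  The P-slot `B8LeafOfRecordSubBP` is KNIT (dag-n05-d D9b p596490 ∕ D9c p597296) and has its
four-pin X-view address (`Record13CarriersXPinnedP{,SViewCoPH}`, this seat).  THIS FILE re-reads the engine there: **h05 : B8LeafOfRecordSubBP θ.toStage3Params lam8** throughout.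

WHAT IS PROVED (kernel bookkeeping BY NAME; 0 sorry; no definition): §3P `N24_nodes₁₃CoPH_pinX3PS_fourPin_pointed` (the thirteen nodes at a world S-bound to the four-pin view of
`θ.pinX3P λ₈ λ₁₂ λ₁₃`), `N24_endStatementBPrinted₁₃CoPH_pinX3PS_fourPin_pointed` ((B) at the datum + β-pair), `N24_stabilityBR13SepCoPH_thetaShape20_pinX3PS_fourPin_pointed` (K1⁷'s θ-keyed
consequent at `(θ, hP)`), `N24_stabilityBR13SepCoPH_thetaShape20_pinX3PS_fourPin_pointed_liveRepin₁₃` (the same witnessed by node00-def-K0a's live re-pin); §4P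
`N24_nodesAtSomeRecordS₁₃SepCoPH_of_pinX3PS_fourPin_pointed` (rung-1 body shape `RecordS ∧ Nodes ∧ PrintedUV3V ∧ 𝐑-leaf reading`), `N24_betaWindowAtSomeRecordS₁₃SepCoPH_of_pinX3PS_fourPin_pointed_of_boxH`
(rung-2 body shape from the β-box pair).  THE HYPOTHESIS LIST IS «WHICH CHILD BLOCKS ON N05's P-SLOT ROUTE»; `h05` is what D9b ∕ D9c conclude at `λ₈ := λ.cutSubB J lan c₁` modulo THEIR
displayed hypotheses ([4]-type sockets at the `Ω₀ = ℤᵈ` law members, `p5e p5u` (resp. `zdLan` letters), `p6`, `p7`).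
HONEST FRAMING: kernel bookkeeping; NO estimate; nothing of Bałaban's asserted; every child `h05 … hUV`, `hlo ∕ hhi`, `hR`, `hK` is a HYPOTHESIS; N05 NOT discharged; N24 COMPOSITE;
K0⁷ ∕ K1⁷ NOT closed; counts unmoved; count-neutral; one finite T⁴ programme at fixed ε — R4 closes ONLY the conditional finite-𝕋⁴ rung `BalabanLadder.UV`; the YM mass gap (Clay) is
NOT proved by any of this; nothing continuum ∕ ℝ⁴ ∕ OS.  No `sorry`, no `axiom`, no `instance`, no `notation`.  Unit `pub-ymgap-dag-n05-w4` (g2), 2026-08-28.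
[Balaban1989LargeFieldII] = Commun. Math. Phys. **122** (1989) 355–392; [Balaban1985RegularSpaces] = Commun. Math. Phys. **99** (1985) 75–102; [Balaban1988Convergent] = Commun. Math.
Phys. **119** (1988) 243–285; [Balaban1987RG1] = Commun. Math. Phys. **109** (1987) 249–301.
-/

noncomputable section

open scoped Matrix.Norms.L2Operator

namespace Literature.MathematicalPhysics.QuantumFieldTheory.Balaban1983to89.Node00

open DagBinding T4Continuum T4DatumAssembly FlowStepRuns AveragingRT
open FlowStep (BetaLowerH BetaUpperH)
open B14NodeKnitRecord9 (b14_main_at_construction_rhoOfRecord9_along)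
open B16NodeKnitRepTowerOfRecord (b16_main_at_repTowerOfRecord_along)
open B16RLeafRecord13LiveCoPH (laws₁₃CoPH_of_liveSel_of_rstep)

variable {F : T4Family} {N : ℕ} [NeZero N]

/-! ## §3P. At the P-PINNED parameter `X' := XPinned₁₃P θ λ₈ λ₁₂ λ₁₃`: N05 ← the P-SLOT `B8LeafOfRecordSubBP θ₃ λ₈`, N09 ← Lemma 4 at the [B12] frame of record, N10 ← the [B13] leaf of record -/

/-- **N24 · THE THIRTEEN DAG NODES AT A WORLD S-BOUND TO THE FOUR-PIN VIEW OF `θ.pinX3P λ₈ λ₁₂ λ₁₃`** (Core-keyed): **N05 ← `B8LeafOfRecordSubBP θ₃ λ₈`** (the P-slot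
dag-n05-d's knits serve); N06 `B9LeafX (Y9OfRecord N θ₃ M⋆ ops)`; N07 `B11Leaf (Z11OfRecord F N ζ)`; **N08 `PrintedUV3V N θ.L`**; **N09 Lemma 4 AT THE [B12] FRAME OF RECORD `λ₁₂`** +
its Theorem-3 member `h09T` DISPLAYED; **N10 the [B13] leaf `B13LeafOfRecord θ₃ (λ₁₃ P)`**; N11 (S1ᵀ) `h11` (its `b8` antecedent is the surviving leaf here); N12
`B15Leaf (WOfRecord₁₃ θ λW P)`; N13 (R₁₃) `hR` + (UV₁₃) `hUV`; N01 ∕ N02 ∕ N04 def-T's transferred theorems and N03 `N24_b6_main_of_isRecordOfRecord₁₃CCoPH` at the C-bound twin,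
N10 at the twin (`B13NodeKnitRecord5C.b13_main_at_stage5ParamsC`), all transported by `rfl` (`withB8`).  THE HYPOTHESIS LIST IS «WHICH CHILD BLOCKS ON N05's SURVIVING ROUTE».
[cite: Balaban1989LargeFieldII, Thm 1 p.355, (0.1) pp.355–356, p.387, p.391; Balaban1985RegularSpaces, Lemma 1 – Thm 8 pp.79–101, Thm 8 (1.146) p.101 (surviving form); Balaban1985UV3, Thm 1 p.257 + Thm 2 p.272; Balaban1985BackgroundPropagators, Thm 3.1 p.397; Balaban1985Variational, Thm 1 p.279 + Thm 3 p.278; Balaban1988Convergent, Thm 1 p.262, Theorem p.245, p.244, (2.18) p.257, Cor. 3 (2.50) p.264; Balaban1987RG1, Thm 1 p.259, Thm 3 p.264, Lemma 4 p.280; Balaban1988RG2Cluster, Lemmas 1–3 pp.9–20; Balaban1989LargeFieldI, Prop. 1 p.194, (0.2)–(0.4) p.176 (bookkeeping)] -/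
theorem N24_nodes₁₃CoPH_pinX3PS_fourPin_pointed (θ : Stage13HParams F N) (hP : θ.Provisos₁₃CoPH F N) (hθ : θ.Admissible F N)
    (lam8 : ResidB8 θ.toStage3Params) (lam12 : ResidB12 F N θ.τ9.M) (lam13 : B12.RunParams → ResidB13 θ.toStage3Params)
    (Mstar : ℕ) (ops : OpsY N θ.toStage3Params Mstar) (ζ : ResidZ F N) (lamW : ResidW F N) (w : WorldP)
    (hC : w.C = (datumOfRecord₁₃CoPH F N θ hP).C) (hγ : 0 < w.γ ∧ w.γ ≤ θ.γ) (hL : w.L = (θ.L : ℝ))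
    (hup : ∀ P, w.up P = upOfRecord₅CS F N ((θ.pinX3P F N lam8 lam12 lam13).view₁₃CoPHB10YZW F N Mstar ops ζ lamW) P)
    (h05 : B8LeafOfRecordSubBP θ.toStage3Params lam8)
    (h06 : B9LeafX (Y9OfRecord N θ.toStage3Params Mstar ops))
    (h07 : B11Leaf (Z11OfRecord F N ζ))
    (h08 : PrintedUV3V N θ.L)
    (h09 : ∀ P : B12.RunParams, B12Sec2to5.Lemma4Printed (F12OfRecord₁₂ F N θ.toStage12Params lam12 P) (lam12 P).consts)
    (h09T : ∀ P : B12.RunParams, (leavesP w P).smallCouplings → (leavesP w P).smallFieldInductive)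
    (h10 : ∀ P : B12.RunParams, B13LeafOfRecord θ.toStage3Params (lam13 P))
    (h11 : ∀ P : B12.RunParams, (leavesP w P).b7 → (leavesP w P).b8 → (leavesP w P).b9 → (leavesP w P).b10 → (leavesP w P).b11 →
      (leavesP w P).smallCouplings → (leavesP w P).smallFieldInductive → (leavesP w P).flowControl →
        ∀ k, k < P.K → SLaw₁₃CoPH F N θ P k → TLaw₁₃CoPH F N θ P k)
    (h12 : ∀ P : B12.RunParams, B15Leaf (WOfRecord₁₃ F N θ.toStage13Params lamW P))
    (hR : ∀ (P : B12.RunParams) (k : ℕ), k < P.K → TLaw₁₃CoPH F N θ P k → SLaw₁₃CoPH F N θ P (k + 1))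
    (hUV : ∀ P : B12.RunParams, (genFlow (betaOfRecord₁₃ F N θ.toStage13Params) P.g0).InInterval w.γ P.K → ∀ k, k ≤ P.K → SLaw₁₃CoPH F N θ P k →
      ∀ U : GaugeField (F.P P.K) k (SU N),
        chiβOfRecord₁₃ F N θ.toStage13Params P.K (gOfRecord₁₃ F N θ.toStage13Params P) k U *
              Real.exp (-(1 / (gOfRecord₁₃ F N θ.toStage13Params P k) ^ 2 * wilsonBGOfRecord F N θ.εbg P k U)
                - w.em (gOfRecord₁₃ F N θ.toStage13Params P k) * (Fintype.card (Site (F.P P.K) k) : ℝ)) ≤ densOfRecord₁₃ F N θ.toStage13Params P k U ∧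
        densOfRecord₁₃ F N θ.toStage13Params P k U ≤ Real.exp (w.ep (gOfRecord₁₃ F N θ.toStage13Params P k) * (Fintype.card (Site (F.P P.K) k) : ℝ))) :
    ∀ P : B12.RunParams, Nodes (leavesP w P) :=
  N24_nodes₁₃CoPH_rebindXS_fourPin_pointed θ hP hθ (XPinned₁₃P F N θ.toStage13Params lam8 lam12 lam13) Mstar ops ζ lamW w hC hγ hL hup
    (fun P => (socket05S_view₁₃CoPHB10YZW_pinX3P_iff F N θ lam8 lam12 lam13 Mstar ops ζ lamW P).2 h05) h06 h07 h08
    (fun P => (socket09_pinX3P_iff F N θ.toStage13Params lam8 lam12 lam13 P).2 (h09 P)) h09T (fun P _ _ _ _ => (socket10_pinX3P_iff F N θ.toStage13Params lam8 lam12 lam13 P).2 (h10 P)) h11 h12 hR hUV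

/-- **N24 · (B2) AT `(datumOfRecord₁₃CoPH θ hP).C` FROM THE POINTED CHILDREN ON N05's SURVIVING ROUTE AND THE β-BOX PAIR** (Core-keyed): node00-def-T's S-bound headline
`endStatementBPrinted_of_nodesP_interval_guarded` AT THE S-BOUND WORLD (no record predicate reads the binding) — nodes by §1, the guarded (0.20) and the β-window from the
C-bound twin record (`rgFlow_of_smallCouplings_of_isRecordOfRecord₁₃CCoPH`, `N24_betaBoundsInInterval_of_isRecordOfRecord₁₃CCoPH_of_boxH`; both read `w.C`, `w.γ` only).
[cite: Balaban1989LargeFieldII, Thm 1 p.355 + p.391; Balaban1987RG1, (0.20) p.256, (1.22) p.264; Balaban1985RegularSpaces, Thm 8 (1.146) p.101 (bookkeeping + elementary window)] -/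
theorem N24_endStatementBPrinted₁₃CoPH_pinX3PS_fourPin_pointed (θ : Stage13HParams F N) (hP : θ.Provisos₁₃CoPH F N) (hθ : θ.Admissible F N)
    (lam8 : ResidB8 θ.toStage3Params) (lam12 : ResidB12 F N θ.τ9.M) (lam13 : B12.RunParams → ResidB13 θ.toStage3Params)
    (Mstar : ℕ) (ops : OpsY N θ.toStage3Params Mstar) (ζ : ResidZ F N) (lamW : ResidW F N) (w : WorldP)
    (hC : w.C = (datumOfRecord₁₃CoPH F N θ hP).C) (hγ : 0 < w.γ ∧ w.γ ≤ θ.γ) (hL : w.L = (θ.L : ℝ))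
    (hup : ∀ P, w.up P = upOfRecord₅CS F N ((θ.pinX3P F N lam8 lam12 lam13).view₁₃CoPHB10YZW F N Mstar ops ζ lamW) P)
    (h05 : B8LeafOfRecordSubBP θ.toStage3Params lam8)
    (h06 : B9LeafX (Y9OfRecord N θ.toStage3Params Mstar ops))
    (h07 : B11Leaf (Z11OfRecord F N ζ))
    (h08 : PrintedUV3V N θ.L)
    (h09 : ∀ P : B12.RunParams, B12Sec2to5.Lemma4Printed (F12OfRecord₁₂ F N θ.toStage12Params lam12 P) (lam12 P).consts)
    (h09T : ∀ P : B12.RunParams, (leavesP w P).smallCouplings → (leavesP w P).smallFieldInductive)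
    (h10 : ∀ P : B12.RunParams, B13LeafOfRecord θ.toStage3Params (lam13 P))
    (h11 : ∀ P : B12.RunParams, (leavesP w P).b7 → (leavesP w P).b8 → (leavesP w P).b9 → (leavesP w P).b10 → (leavesP w P).b11 →
      (leavesP w P).smallCouplings → (leavesP w P).smallFieldInductive → (leavesP w P).flowControl →
        ∀ k, k < P.K → SLaw₁₃CoPH F N θ P k → TLaw₁₃CoPH F N θ P k)
    (h12 : ∀ P : B12.RunParams, B15Leaf (WOfRecord₁₃ F N θ.toStage13Params lamW P))
    (hR : ∀ (P : B12.RunParams) (k : ℕ), k < P.K → TLaw₁₃CoPH F N θ P k → SLaw₁₃CoPH F N θ P (k + 1))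
    (hUV : ∀ P : B12.RunParams, (genFlow (betaOfRecord₁₃ F N θ.toStage13Params) P.g0).InInterval w.γ P.K → ∀ k, k ≤ P.K → SLaw₁₃CoPH F N θ P k →
      ∀ U : GaugeField (F.P P.K) k (SU N),
        chiβOfRecord₁₃ F N θ.toStage13Params P.K (gOfRecord₁₃ F N θ.toStage13Params P) k U *
              Real.exp (-(1 / (gOfRecord₁₃ F N θ.toStage13Params P k) ^ 2 * wilsonBGOfRecord F N θ.εbg P k U)
                - w.em (gOfRecord₁₃ F N θ.toStage13Params P k) * (Fintype.card (Site (F.P P.K) k) : ℝ)) ≤ densOfRecord₁₃ F N θ.toStage13Params P k U ∧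
        densOfRecord₁₃ F N θ.toStage13Params P k U ≤ Real.exp (w.ep (gOfRecord₁₃ F N θ.toStage13Params P k) * (Fintype.card (Site (F.P P.K) k) : ℝ))) 
    (hlo : BetaLowerH w.b w.γ (datumOfRecord₁₃CoPH F N θ hP).βfun) (hhi : BetaUpperH w.βup w.γ (datumOfRecord₁₃CoPH F N θ hP).βfun) :
    B16.EndStatementBPrinted (datumOfRecord₁₃CoPH F N θ hP).C :=
  N24_endStatementBPrinted₁₃CoPH_rebindXS_fourPin_pointed θ hP hθ (XPinned₁₃P F N θ.toStage13Params lam8 lam12 lam13) Mstar ops ζ lamW w hC hγ hL hup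
    (fun P => (socket05S_view₁₃CoPHB10YZW_pinX3P_iff F N θ lam8 lam12 lam13 Mstar ops ζ lamW P).2 h05) h06 h07 h08
    (fun P => (socket09_pinX3P_iff F N θ.toStage13Params lam8 lam12 lam13 P).2 (h09 P)) h09T (fun P _ _ _ _ => (socket10_pinX3P_iff F N θ.toStage13Params lam8 lam12 lam13 P).2 (h10 P)) h11 h12 hR hUV hlo hhi

/-- **★ ITEM K1⁷ (stmt-QuantumFields-20542)'s θ-KEYED CONSEQUENT, WITNESSED BY `(θ, hP)`, FROM THE POINTED CHILDREN ON N05's SURVIVING ROUTE** — the world S-bound to the four-pin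
view of the P-pinned parameter, N05 ← the P-slot, guard `hU` displayed; (B) by the previous theorem at `hP.toCore` (datum bridge `rfl`), window by module 26.
COMPOSITE: nothing is discharged. [cite: Balaban1989LargeFieldII, Thm 1 p.355, (0.1) pp.355–356, p.391; Balaban1985RegularSpaces, Thm 8 (1.146) p.101; Balaban1987RG1, Thm 3 p.264, (0.17)–(0.20) pp.255–256 and (1.22) p.264; Balaban1985UV3, Thm 1 p.257 (bookkeeping + elementary window)] -/
theorem N24_stabilityBR13SepCoPH_thetaShape20_pinX3PS_fourPin_pointed (θ : Stage13HParams F N) (hP : θ.Provisos₁₃SepCoPH F N) (hθ : θ.Admissible F N)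
    (hU : θ.ZhUnity F N ∧ θ.SlotsNondegenerate₁₃ F N)
    (lam8 : ResidB8 θ.toStage3Params) (lam12 : ResidB12 F N θ.τ9.M) (lam13 : B12.RunParams → ResidB13 θ.toStage3Params)
    (Mstar : ℕ) (ops : OpsY N θ.toStage3Params Mstar) (ζ : ResidZ F N) (lamW : ResidW F N) (w : WorldP)
    (hC : w.C = (datumOfRecord₁₃SepCoPH F N θ hP).C) (hγ : 0 < w.γ ∧ w.γ ≤ θ.γ) (hL : w.L = (θ.L : ℝ))
    (hup : ∀ P, w.up P = upOfRecord₅CS F N ((θ.pinX3P F N lam8 lam12 lam13).view₁₃CoPHB10YZW F N Mstar ops ζ lamW) P)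
    (h05 : B8LeafOfRecordSubBP θ.toStage3Params lam8)
    (h06 : B9LeafX (Y9OfRecord N θ.toStage3Params Mstar ops))
    (h07 : B11Leaf (Z11OfRecord F N ζ))
    (h08 : PrintedUV3V N θ.L)
    (h09 : ∀ P : B12.RunParams, B12Sec2to5.Lemma4Printed (F12OfRecord₁₂ F N θ.toStage12Params lam12 P) (lam12 P).consts)
    (h09T : ∀ P : B12.RunParams, (leavesP w P).smallCouplings → (leavesP w P).smallFieldInductive)
    (h10 : ∀ P : B12.RunParams, B13LeafOfRecord θ.toStage3Params (lam13 P))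
    (h11 : ∀ P : B12.RunParams, (leavesP w P).b7 → (leavesP w P).b8 → (leavesP w P).b9 → (leavesP w P).b10 → (leavesP w P).b11 →
      (leavesP w P).smallCouplings → (leavesP w P).smallFieldInductive → (leavesP w P).flowControl →
        ∀ k, k < P.K → SLaw₁₃CoPH F N θ P k → TLaw₁₃CoPH F N θ P k)
    (h12 : ∀ P : B12.RunParams, B15Leaf (WOfRecord₁₃ F N θ.toStage13Params lamW P))
    (hR : ∀ (P : B12.RunParams) (k : ℕ), k < P.K → TLaw₁₃CoPH F N θ P k → SLaw₁₃CoPH F N θ P (k + 1))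
    (hUV : ∀ P : B12.RunParams, (genFlow (betaOfRecord₁₃ F N θ.toStage13Params) P.g0).InInterval w.γ P.K → ∀ k, k ≤ P.K → SLaw₁₃CoPH F N θ P k →
      ∀ U : GaugeField (F.P P.K) k (SU N),
        chiβOfRecord₁₃ F N θ.toStage13Params P.K (gOfRecord₁₃ F N θ.toStage13Params P) k U *
              Real.exp (-(1 / (gOfRecord₁₃ F N θ.toStage13Params P k) ^ 2 * wilsonBGOfRecord F N θ.εbg P k U)
                - w.em (gOfRecord₁₃ F N θ.toStage13Params P k) * (Fintype.card (Site (F.P P.K) k) : ℝ)) ≤ densOfRecord₁₃ F N θ.toStage13Params P k U ∧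
        densOfRecord₁₃ F N θ.toStage13Params P k U ≤ Real.exp (w.ep (gOfRecord₁₃ F N θ.toStage13Params P k) * (Fintype.card (Site (F.P P.K) k) : ℝ))) 
    (hlo : BetaLowerH w.b w.γ (datumOfRecord₁₃SepCoPH F N θ hP).βfun) (hhi : BetaUpperH w.βup w.γ (datumOfRecord₁₃SepCoPH F N θ hP).βfun) :
    ∃ (θ' : Stage13HParams F N) (h' : θ'.Provisos₁₃SepCoPH F N), (θ'.ZhUnity F N ∧ θ'.SlotsNondegenerate₁₃ F N) ∧ θ'.Admissible F N ∧
      B16.EndStatementBPrinted (datumOfRecord₁₃SepCoPH F N θ' h').C ∧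
      ∃ γ₁ : ℝ, 0 < γ₁ ∧ ∀ γ : ℝ, 0 < γ → γ ≤ γ₁ → ∃ P : B12.RunParams, 1 ≤ P.K ∧ ((datumOfRecord₁₃SepCoPH F N θ' h').C P).flow.InInterval γ P.K :=
  N24_stabilityBR13SepCoPH_thetaShape20_rebindXS_fourPin_pointed θ hP hθ hU (XPinned₁₃P F N θ.toStage13Params lam8 lam12 lam13) Mstar ops ζ lamW w hC hγ hL hup
    (fun P => (socket05S_view₁₃CoPHB10YZW_pinX3P_iff F N θ lam8 lam12 lam13 Mstar ops ζ lamW P).2 h05) h06 h07 h08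
    (fun P => (socket09_pinX3P_iff F N θ.toStage13Params lam8 lam12 lam13 P).2 (h09 P)) h09T (fun P _ _ _ _ => (socket10_pinX3P_iff F N θ.toStage13Params lam8 lam12 lam13 P).2 (h10 P)) h11 h12 hR hUV hlo hhi

/-- **★ THE SAME WITNESSED BY node00-def-K0a's LIVE RE-PIN `(θ.liveRepin₁₃, hP)`** — N13's (R₁₃) (dag-n11-e's `laws₁₃CoPH_of_liveSel_of_rstep` fed by `hP.rstep` at `liveRepin₁₃_ppSel`),
`Admissible` (`Admissible.liveRepin₁₃`), `SlotsNondegenerate₁₃` (K0a's `slotsNondegenerate₁₃_liveRepin_of_int` from `hP.tstep ∕ hP.rstep`) DISCHARGED BY NAME; `hZ` displayed.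
WHICH CHILD BLOCKS FOR K1⁷ ON THE LIVE LINE AND N05's SURVIVING ROUTE = this hypothesis list. [cite: Balaban1989LargeFieldII, Thm 1 p.355, (0.1) pp.355–356, p.391; Balaban1988Convergent, p.244, Thm 2 p.263, (3.16)–(3.22) pp.268–269; Balaban1989LargeFieldI, (0.3)–(0.4) p.176; Balaban1985RegularSpaces, Thm 8 (1.146) p.101; Balaban1987RG1, Thm 3 p.264, (0.17)–(0.21) pp.255–256 and (1.22) p.264 (bookkeeping + elementary window)] -/
theorem N24_stabilityBR13SepCoPH_thetaShape20_pinX3PS_fourPin_pointed_liveRepin₁₃ (θ : Stage13Params F N) (Zr : (q : B12.RunParams) → TkResidualW F N (FluctV N) q.K) (Zh : (q : B12.RunParams) → ℕ → (ℕ → Set (Site (F.P q.K) 0)) → (ℕ → Set (Site (F.P q.K) 0)) → TkResidualW F N (FluctV N) q.K) (Phih : (q : B12.RunParams) → ℕ → (ℕ → Set (Site (F.P q.K) 0)) → (ℕ → Set (Site (F.P q.K) 0)) → (ℕ → Plaq (F.P q.K) 0 → ℝ)) (hP : (⟨⟨θ.liveRepin₁₃ F N, Zr⟩, Zh, Phih⟩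 : Stage13HParams F N).Provisos₁₃SepCoPH F N)
    (hθ : θ.Admissible F N) (hZh : (⟨⟨θ.liveRepin₁₃ F N, Zr⟩, Zh, Phih⟩ : Stage13HParams F N).ZhUnity F N) (hκ : 0 ≤ θ.s2.lf.κ) (hE₀ : 0 ≤ θ.s2.lf.E₀) (hB₀ : 0 ≤ θ.s2.lf.B₀)
    (lam8 : ResidB8 (θ.liveRepin₁₃ F N).toStage3Params) (lam12 : ResidB12 F N (θ.liveRepin₁₃ F N).τ9.M) (lam13 : B12.RunParams → ResidB13 (θ.liveRepin₁₃ F N).toStage3Params)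
    (Mstar : ℕ) (ops : OpsY N (θ.liveRepin₁₃ F N).toStage3Params Mstar) (ζ : ResidZ F N) (lamW : ResidW F N) (w : WorldP)
    (hC : w.C = (datumOfRecord₁₃SepCoPH F N (⟨⟨θ.liveRepin₁₃ F N, Zr⟩, Zh, Phih⟩ : Stage13HParams F N) hP).C) (hγ : 0 < w.γ ∧ w.γ ≤ (θ.liveRepin₁₃ F N).γ) (hL : w.L = ((θ.liveRepin₁₃ F N).L : ℝ))
    (hup : ∀ P, w.up P = upOfRecord₅CS F N (((⟨⟨θ.liveRepin₁₃ F N, Zr⟩, Zh, Phih⟩ : Stage13HParams F N).pinX3P F N lam8 lam12 lam13).view₁₃CoPHB10YZW F N Mstar ops ζ lamW) P)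
    (h05 : B8LeafOfRecordSubBP (θ.liveRepin₁₃ F N).toStage3Params lam8)
    (h06 : B9LeafX (Y9OfRecord N (θ.liveRepin₁₃ F N).toStage3Params Mstar ops))
    (h07 : B11Leaf (Z11OfRecord F N ζ))
    (h08 : PrintedUV3V N (θ.liveRepin₁₃ F N).L)
    (h09 : ∀ P : B12.RunParams, B12Sec2to5.Lemma4Printed (F12OfRecord₁₂ F N (θ.liveRepin₁₃ F N).toStage12Params lam12 P) (lam12 P).consts)
    (h09T : ∀ P : B12.RunParams, (leavesP w P).smallCouplings → (leavesP w P).smallFieldInductive)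
    (h10 : ∀ P : B12.RunParams, B13LeafOfRecord (θ.liveRepin₁₃ F N).toStage3Params (lam13 P))
    (h11 : ∀ P : B12.RunParams, (leavesP w P).b7 → (leavesP w P).b8 → (leavesP w P).b9 → (leavesP w P).b10 → (leavesP w P).b11 →
      (leavesP w P).smallCouplings → (leavesP w P).smallFieldInductive → (leavesP w P).flowControl →
        ∀ k, k < P.K → SLaw₁₃CoPH F N (⟨⟨θ.liveRepin₁₃ F N, Zr⟩, Zh, Phih⟩ : Stage13HParams F N) P k → TLaw₁₃CoPH F N (⟨⟨θ.liveRepin₁₃ F N, Zr⟩, Zh, Phih⟩ : Stage13HParams F N) P k)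
    (h12 : ∀ P : B12.RunParams, B15Leaf (WOfRecord₁₃ F N (θ.liveRepin₁₃ F N) lamW P))
    (hUV : ∀ P : B12.RunParams, (genFlow (betaOfRecord₁₃ F N (θ.liveRepin₁₃ F N)) P.g0).InInterval w.γ P.K → ∀ k, k ≤ P.K → SLaw₁₃CoPH F N (⟨⟨θ.liveRepin₁₃ F N, Zr⟩, Zh, Phih⟩ : Stage13HParams F N) P k →
      ∀ U : GaugeField (F.P P.K) k (SU N),
        chiβOfRecord₁₃ F N (θ.liveRepin₁₃ F N) P.K (gOfRecord₁₃ F N (θ.liveRepin₁₃ F N) P) k U *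
              Real.exp (-(1 / (gOfRecord₁₃ F N (θ.liveRepin₁₃ F N) P k) ^ 2 * wilsonBGOfRecord F N (θ.liveRepin₁₃ F N).εbg P k U)
                - w.em (gOfRecord₁₃ F N (θ.liveRepin₁₃ F N) P k) * (Fintype.card (Site (F.P P.K) k) : ℝ)) ≤ densOfRecord₁₃ F N (θ.liveRepin₁₃ F N) P k U ∧
        densOfRecord₁₃ F N (θ.liveRepin₁₃ F N) P k U ≤ Real.exp (w.ep (gOfRecord₁₃ F N (θ.liveRepin₁₃ F N) P k) * (Fintype.card (Site (F.P P.K) k) : ℝ))) 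
    (hlo : BetaLowerH w.b w.γ (datumOfRecord₁₃SepCoPH F N (⟨⟨θ.liveRepin₁₃ F N, Zr⟩, Zh, Phih⟩ : Stage13HParams F N) hP).βfun)
    (hhi : BetaUpperH w.βup w.γ (datumOfRecord₁₃SepCoPH F N (⟨⟨θ.liveRepin₁₃ F N, Zr⟩, Zh, Phih⟩ : Stage13HParams F N) hP).βfun) :
    ∃ (θ' : Stage13HParams F N) (h' : θ'.Provisos₁₃SepCoPH F N), (θ'.ZhUnity F N ∧ θ'.SlotsNondegenerate₁₃ F N) ∧ θ'.Admissible F N ∧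
      B16.EndStatementBPrinted (datumOfRecord₁₃SepCoPH F N θ' h').C ∧
      ∃ γ₁ : ℝ, 0 < γ₁ ∧ ∀ γ : ℝ, 0 < γ → γ ≤ γ₁ → ∃ P : B12.RunParams, 1 ≤ P.K ∧ ((datumOfRecord₁₃SepCoPH F N θ' h').C P).flow.InInterval γ P.K :=
  N24_stabilityBR13SepCoPH_thetaShape20_pinX3PS_fourPin_pointed (⟨⟨θ.liveRepin₁₃ F N, Zr⟩, Zh, Phih⟩ : Stage13HParams F N) hP (Stage13Params.Admissible.liveRepin₁₃ hθ)
    ⟨hZh, (Stage13Params.slotsNondegenerate₁₃_liveRepin_of_int F N θ (fun p j hj => hP.tstep p j hj) (fun p j _ hj => hP.rstep p j hj))⟩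
    lam8 lam12 lam13 Mstar ops ζ lamW w hC hγ hL hup h05 h06 h07 h08 h09 h09T h10 h11 h12
    (fun P k hk => laws₁₃CoPH_of_liveSel_of_rstep F N (⟨⟨θ.liveRepin₁₃ F N, Zr⟩, Zh, Phih⟩ : Stage13HParams F N) P (fun p k _ hk => hP.rstep p k hk) (Stage13Params.Admissible.liveRepin₁₃ hθ) hκ hE₀ hB₀
      (Stage13Params.liveRepin₁₃_ppSel F N θ) k hk) hUV hlo hhi

/-! ## §4P. The REGISTERED RUNG-BODY SHAPES (`RecordS ∧ Nodes ∧ PrintedUV3V ∧ 𝐑-leaf reading`; the β-window body) over the S-bound four-pin view of the P-PINNED parameter (dag-n24-c's X′-generic §4 at `X' := XPinned₁₃P …`) -/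

/-- **RUNG 1's BODY AT THIS SEAT's P-PIN** (`X' := XPinned₁₃P θ λ₈ λ₁₂ λ₁₃`; v1.1 doc fix, ref-L READ #280 NIT: the H-instances are dag-n24-c's, the H-pin dag-n05-d's — this file is the P-pin image): N05 ← `B8LeafOfRecordSubBP θ₃ λ₈`, N09 ← Lemma 4 at `F12OfRecord₁₂ θ₁₂ λ₁₂`, N10 ← `B13LeafOfRecord θ₃ (λ₁₃ P)`
(the previous theorem through the three `Iff.rfl` sockets and §0's `b8` reading). [cite: Balaban1989LargeFieldII, Thm 1 p.355, (0.1) pp.355–356, p.391; Balaban1985RegularSpaces, Thm 8 (1.146) p.101; Balaban1985UV3, Thm 1 p.257 + Thm 2 p.272; Balaban1989LargeFieldI, Prop. 1 p.194; Balaban1987RG1, Thm 3 p.264, Lemma 4 p.280; Balaban1988RG2Cluster, Lemmas 1–3 pp.9–20 (bookkeeping)] -/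
theorem N24_nodesAtSomeRecordS₁₃SepCoPH_of_pinX3PS_fourPin_pointed (θ : Stage13HParams F N) (hP : θ.Provisos₁₃SepCoPH F N) (hθ : θ.Admissible F N)
    (hU : θ.ZhUnity F N ∧ θ.SlotsNondegenerate₁₃ F N)
    (lam8 : ResidB8 θ.toStage3Params) (lam12 : ResidB12 F N θ.τ9.M) (lam13 : B12.RunParams → ResidB13 θ.toStage3Params)
    (Mstar : ℕ) (ops : OpsY N θ.toStage3Params Mstar) (ζ : ResidZ F N) (lamW : ResidW F N) (w : WorldP)
    (hC : w.C = (datumOfRecord₁₃SepCoPH F N θ hP).C) (hγ : 0 < w.γ ∧ w.γ ≤ θ.γ) (hL : w.L = (θ.L : ℝ))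
    (hup : ∀ P, w.up P = upOfRecord₅CS F N ((θ.pinX3P F N lam8 lam12 lam13).view₁₃CoPHB10YZW F N Mstar ops ζ lamW) P)
    (h05 : B8LeafOfRecordSubBP θ.toStage3Params lam8)
    (h06 : B9LeafX (Y9OfRecord N θ.toStage3Params Mstar ops))
    (h07 : B11Leaf (Z11OfRecord F N ζ))
    (h08 : PrintedUV3V N θ.L)
    (h09 : ∀ P : B12.RunParams, B12Sec2to5.Lemma4Printed (F12OfRecord₁₂ F N θ.toStage12Params lam12 P) (lam12 P).consts)
    (h09T : ∀ P : B12.RunParams, (leavesP w P).smallCouplings → (leavesP w P).smallFieldInductive)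
    (h10 : ∀ P : B12.RunParams, B13LeafOfRecord θ.toStage3Params (lam13 P))
    (h11 : ∀ P : B12.RunParams, (leavesP w P).b7 → (leavesP w P).b8 → (leavesP w P).b9 → (leavesP w P).b10 → (leavesP w P).b11 →
      (leavesP w P).smallCouplings → (leavesP w P).smallFieldInductive → (leavesP w P).flowControl →
        ∀ k, k < P.K → SLaw₁₃CoPH F N θ P k → TLaw₁₃CoPH F N θ P k)
    (h12 : ∀ P : B12.RunParams, B15Leaf (WOfRecord₁₃ F N θ.toStage13Params lamW P))
    (hR : ∀ (P : B12.RunParams) (k : ℕ), k < P.K → TLaw₁₃CoPH F N θ P k → SLaw₁₃CoPH F N θ P (k + 1))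
    (hUV : ∀ P : B12.RunParams, (genFlow (betaOfRecord₁₃ F N θ.toStage13Params) P.g0).InInterval w.γ P.K → ∀ k, k ≤ P.K → SLaw₁₃CoPH F N θ P k →
      ∀ U : GaugeField (F.P P.K) k (SU N),
        chiβOfRecord₁₃ F N θ.toStage13Params P.K (gOfRecord₁₃ F N θ.toStage13Params P) k U *
              Real.exp (-(1 / (gOfRecord₁₃ F N θ.toStage13Params P k) ^ 2 * wilsonBGOfRecord F N θ.εbg P k U)
                - w.em (gOfRecord₁₃ F N θ.toStage13Params P k) * (Fintype.card (Site (F.P P.K) k) : ℝ)) ≤ densOfRecord₁₃ F N θ.toStage13Params P k U ∧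
        densOfRecord₁₃ F N θ.toStage13Params P k U ≤ Real.exp (w.ep (gOfRecord₁₃ F N θ.toStage13Params P k) * (Fintype.card (Site (F.P P.K) k) : ℝ)))
    (hK : ∀ P : B12.RunParams, 1 ≤ P.K → lamW.kSel P < P.K) :
    ∃ (θ : Stage13HParams F N) (hP : θ.Provisos₁₃SepCoPH F N) (w : WorldP), (θ.ZhUnity F N ∧ θ.SlotsNondegenerate₁₃ F N) ∧ θ.Admissible F N ∧
      (∃ (θ' : Stage13HParams F N) (h' : θ'.Provisos₁₃SepCoPH F N), θ'.Admissible F N ∧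
      datumOfRecord₁₃SepCoPH F N θ hP = datumOfRecord₁₃SepCoPH F N θ' h' ∧ w.C = (datumOfRecord₁₃SepCoPH F N θ hP).C ∧ (0 < w.γ ∧ w.γ ≤ θ'.γ) ∧
      w.L = (θ'.L : ℝ) ∧ ∀ P : B12.RunParams, w.up P = upOfRecord₅CS F N (θ'.toStage5₁₃CoPH F N) P) ∧
      (∀ P : B12.RunParams, Nodes (leavesP w P)) ∧ PrintedUV3V N θ.L ∧
      ∃ lam : ResidW F N, (∀ P : B12.RunParams, 1 ≤ P.K → lam.kSel P < P.K) ∧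
        ∀ P : B12.RunParams, lam.kSel P < P.K → ((leavesP w P).rBasicStep ↔ B15Leaf (WOfRecord₁₃ F N θ.toStage13Params lam P)) :=
  N24_nodesAtSomeRecordS₁₃SepCoPH_of_rebindXS_fourPin_pointed θ hP hθ hU (XPinned₁₃P F N θ.toStage13Params lam8 lam12 lam13) Mstar ops ζ lamW w hC hγ hL hup
    (fun P => (socket05S_view₁₃CoPHB10YZW_pinX3P_iff F N θ lam8 lam12 lam13 Mstar ops ζ lamW P).2 h05) h06 h07 h08
    (fun P => (socket09_pinX3P_iff F N θ.toStage13Params lam8 lam12 lam13 P).2 (h09 P)) h09T (fun P _ _ _ _ => (socket10_pinX3P_iff F N θ.toStage13Params lam8 lam12 lam13 P).2 (h10 P)) h11 h12 hR hUV hK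

/-- **RUNG 2's BODY AT THIS SEAT's P-PIN** (`X' := XPinned₁₃P θ λ₈ λ₁₂ λ₁₃`; v1.1 doc fix, ref-L READ #280 NIT: the H-instances are dag-n24-c's, the H-pin dag-n05-d's — this file is the P-pin image), from the pointed children on N05's surviving route and the β-box pair.
[cite: Balaban1989LargeFieldII, Thm 1 p.355, (0.1) pp.355–356, p.391; Balaban1987RG1, Thm 3 p.264, (0.17)–(0.20) pp.255–256 and (1.22) p.264; Balaban1985RegularSpaces, Thm 8 (1.146) p.101 (bookkeeping + elementary window)] -/
theorem N24_betaWindowAtSomeRecordS₁₃SepCoPH_of_pinX3PS_fourPin_pointed_of_boxH (θ : Stage13HParams F N) (hP : θ.Provisos₁₃SepCoPH F N) (hθ : θ.Admissible F N)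
    (hU : θ.ZhUnity F N ∧ θ.SlotsNondegenerate₁₃ F N)
    (lam8 : ResidB8 θ.toStage3Params) (lam12 : ResidB12 F N θ.τ9.M) (lam13 : B12.RunParams → ResidB13 θ.toStage3Params)
    (Mstar : ℕ) (ops : OpsY N θ.toStage3Params Mstar) (ζ : ResidZ F N) (lamW : ResidW F N) (w : WorldP)
    (hC : w.C = (datumOfRecord₁₃SepCoPH F N θ hP).C) (hγ : 0 < w.γ ∧ w.γ ≤ θ.γ) (hL : w.L = (θ.L : ℝ))
    (hup : ∀ P, w.up P = upOfRecord₅CS F N ((θ.pinX3P F N lam8 lam12 lam13).view₁₃CoPHB10YZW F N Mstar ops ζ lamW) P)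
    (h05 : B8LeafOfRecordSubBP θ.toStage3Params lam8)
    (h06 : B9LeafX (Y9OfRecord N θ.toStage3Params Mstar ops))
    (h07 : B11Leaf (Z11OfRecord F N ζ))
    (h08 : PrintedUV3V N θ.L)
    (h09 : ∀ P : B12.RunParams, B12Sec2to5.Lemma4Printed (F12OfRecord₁₂ F N θ.toStage12Params lam12 P) (lam12 P).consts)
    (h09T : ∀ P : B12.RunParams, (leavesP w P).smallCouplings → (leavesP w P).smallFieldInductive)
    (h10 : ∀ P : B12.RunParams, B13LeafOfRecord θ.toStage3Params (lam13 P))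
    (h11 : ∀ P : B12.RunParams, (leavesP w P).b7 → (leavesP w P).b8 → (leavesP w P).b9 → (leavesP w P).b10 → (leavesP w P).b11 →
      (leavesP w P).smallCouplings → (leavesP w P).smallFieldInductive → (leavesP w P).flowControl →
        ∀ k, k < P.K → SLaw₁₃CoPH F N θ P k → TLaw₁₃CoPH F N θ P k)
    (h12 : ∀ P : B12.RunParams, B15Leaf (WOfRecord₁₃ F N θ.toStage13Params lamW P))
    (hR : ∀ (P : B12.RunParams) (k : ℕ), k < P.K → TLaw₁₃CoPH F N θ P k → SLaw₁₃CoPH F N θ P (k + 1))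
    (hUV : ∀ P : B12.RunParams, (genFlow (betaOfRecord₁₃ F N θ.toStage13Params) P.g0).InInterval w.γ P.K → ∀ k, k ≤ P.K → SLaw₁₃CoPH F N θ P k →
      ∀ U : GaugeField (F.P P.K) k (SU N),
        chiβOfRecord₁₃ F N θ.toStage13Params P.K (gOfRecord₁₃ F N θ.toStage13Params P) k U *
              Real.exp (-(1 / (gOfRecord₁₃ F N θ.toStage13Params P k) ^ 2 * wilsonBGOfRecord F N θ.εbg P k U)
                - w.em (gOfRecord₁₃ F N θ.toStage13Params P k) * (Fintype.card (Site (F.P P.K) k) : ℝ)) ≤ densOfRecord₁₃ F N θ.toStage13Params P k U ∧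
        densOfRecord₁₃ F N θ.toStage13Params P k U ≤ Real.exp (w.ep (gOfRecord₁₃ F N θ.toStage13Params P k) * (Fintype.card (Site (F.P P.K) k) : ℝ)))
    (hlo : BetaLowerH w.b w.γ (datumOfRecord₁₃SepCoPH F N θ hP).βfun) (hhi : BetaUpperH w.βup w.γ (datumOfRecord₁₃SepCoPH F N θ hP).βfun) :
    ∃ (θ : Stage13HParams F N) (hP : θ.Provisos₁₃SepCoPH F N) (w : WorldP), (θ.ZhUnity F N ∧ θ.SlotsNondegenerate₁₃ F N) ∧ θ.Admissible F N ∧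
      (∃ (θ' : Stage13HParams F N) (h' : θ'.Provisos₁₃SepCoPH F N), θ'.Admissible F N ∧
      datumOfRecord₁₃SepCoPH F N θ hP = datumOfRecord₁₃SepCoPH F N θ' h' ∧ w.C = (datumOfRecord₁₃SepCoPH F N θ hP).C ∧ (0 < w.γ ∧ w.γ ≤ θ'.γ) ∧
      w.L = (θ'.L : ℝ) ∧ ∀ P : B12.RunParams, w.up P = upOfRecord₅CS F N (θ'.toStage5₁₃CoPH F N) P) ∧
      (∀ P : B12.RunParams, Nodes (leavesP w P)) ∧ BetaBoundsInInterval w.C.toB12 w.γ w.b w.βup ∧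
      ∃ γ₁ : ℝ, 0 < γ₁ ∧ ∀ γ : ℝ, 0 < γ → γ ≤ γ₁ → ∃ P : B12.RunParams, 1 ≤ P.K ∧ ((datumOfRecord₁₃SepCoPH F N θ hP).C P).flow.InInterval γ P.K :=
  N24_betaWindowAtSomeRecordS₁₃SepCoPH_of_rebindXS_fourPin_pointed_of_boxH θ hP hθ hU (XPinned₁₃P F N θ.toStage13Params lam8 lam12 lam13) Mstar ops ζ lamW w hC hγ hL hup
    (fun P => (socket05S_view₁₃CoPHB10YZW_pinX3P_iff F N θ lam8 lam12 lam13 Mstar ops ζ lamW P).2 h05) h06 h07 h08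
    (fun P => (socket09_pinX3P_iff F N θ.toStage13Params lam8 lam12 lam13 P).2 (h09 P)) h09T (fun P _ _ _ _ => (socket10_pinX3P_iff F N θ.toStage13Params lam8 lam12 lam13 P).2 (h10 P)) h11 h12 hR hUV hlo hhi

end Literature.MathematicalPhysics.QuantumFieldTheory.Balaban1983to89.Node00

end
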